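import Mathlib
import Summits.ValiantsHypothesis.ValiantsHypothesis.Theorems.RigidityForcesSymmetryRankRigidMinimalReprLaplaceFiveSeparatedCaptureTripleFree
import Summits.ValiantsHypothesis.ValiantsHypothesis.Theorems.RigidityForcesSymmetryRankRigidMinimalReprLaplaceFiveSeparatedCaptureBinaryNet
import Summits.ValiantsHypothesis.ValiantsHypothesis.Theorems.RigidityForcesSymmetryRankRigidMinimalReprLaplaceFiveSeparatedCaptureLineInTwoPlanes

/-!
# ValiantsHypothesis / RigidityForcesSymmetry — crux `LaplaceOptimalFive` (stmt-ValiantsHypothesis-24813), symmetric capture: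
# ★★ **`CaptureIneqSym` FOR THE `(2,2,2)♭` TRIANGLE FAMILY** (three spans with trivial triple intersection in a 3-space)

val-lit-p6 g18 ↔ crit-3 g9 (2026-08-29; located note `pub/val-lit/lmr/NOTE-p6g18-24813-222flat-located.md` and crit-3's verdict
12:35:22Z).  Three symmetric spans `U₀₁, U₀₂, U₁₂ ≤ X`, `finrank X ≤ 3`, with `U₀₁ ⊓ U₀₂ ⊓ U₁₂ = ⊥` and total finrank `≥ 6` —
the «triangle» sub-family of the profile `(2,2,2)♭` (three planes of a 3-space of quadrics pairwise meeting in three independent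
lines) — satisfy the capture inequality.  Dichotomy on the prolongation of `X`:

* `finrank (prolong X) ≤ 3`: the two-pencil bound ✓ `finrank_le_prolong_add_prolong_of_inf_eq_bot` (`…TripleFree`) gives
  `finrank W ≤ 2·3 = 6`;
* `finrank (prolong X) = 4`: ✓ `exists_rows_le_two_of_finrank_prolong` (`…BinaryNet`) makes `X` a binary net — all rows in a plane
  `L` — so all matrices of `X` kill `K = L^⊥` (`finrank K ≥ 3`, via the pairing `k ↦ (l ↦ l·k)` into `Dual L`), and the **binary
  kill** applies: the `K`-contractions `Σ_r k_r A_r` of the finite form lie in `U₀₁ ⊓ U₀₂ ⊓ U₁₂ = ⊥` by the two pencils, hence every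
  contraction `T_μ(p,q,·)·k` vanishes, the contraction map `v ↦ T_μ(·,·,v)` has rank `≤ 2`, yet its range contains the slices of
  `T_μ`, three of which are independent if `T_μ ≠ 0` is square-free ⇒ `T_μ = 0`, `W = 0`.

* `three_le_finrank_of_sqfree_slices` — a nonzero symmetric square-free tensor with slices in `Y` forces `3 ≤ finrank Y`.
* ★ `finrank_eq_zero_of_triple_free_of_common_kernel` — the binary kill (`finrank W = 0`).
* ★★ `captureIneqSym_of_triangle` — the theorem.

Honest framing.  `(SC)` for the triangle sub-family of `(2,2,2)♭` only; two-equal-plus-line, common line (flat and non-flat), spans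
of finrank `≥ 3` in general, `CaptureIneqSym` in general, K1 on `K₃ ⊔ K₂`, `LaplaceOptimalFive` (OPEN · CONTESTED 72/120),
`RankRigidMinimalRepr` and `VP ≠ VNP` are NOT proved here.  No definitions, no `sorry`.
-/

set_option linter.dupNamespace false
set_option autoImplicit false

namespace Summit.ValiantsHypothesis.ValiantsHypothesis.Theorems.RigidityForcesSymmetryRankRigidMinimalRepr

namespace LaplaceFiveSeparatedCapture

open Finset

/-- A nonzero symmetric square-free 3-tensor whose slices lie in `Y` forces `3 ≤ finrank Y`: the three slices at an injective
support entry are linearly independent. [folklore] -/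
theorem three_le_finrank_of_sqfree_slices (Y : Submodule ℂ (Fin 5 → Fin 5 → ℂ))
    (g : Fin 5 → Fin 5 → Fin 5 → ℂ) (h12 : ∀ p q r, g p q r = g q p r) (h23 : ∀ p q r, g p q r = g p r q)
    (hsq : ∀ p r, g p p r = 0) (hne : g ≠ 0) (hg : ∀ p, g p ∈ Y) : 3 ≤ Module.finrank ℂ Y := by
  classical
  obtain ⟨i, j, k, -, -, -, hijk⟩ := exists_inj_of_sqfree_ne_zero g h12 h23 hsq hne
  have e1 : g j j k = 0 := hsq j k
  have e2 : g k j k = 0 := by rw [h23]; exact hsq k j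
  have e3 : g i i k = 0 := hsq i k
  have e4 : g k i k = 0 := by rw [h23]; exact hsq k i
  have e5 : g i i j = 0 := hsq i j
  have e6 : g j i j = 0 := by rw [h23]; exact hsq j i
  have e7 : g j i k = g i j k := (h12 i j k).symm
  have e8 : g k i j = g i j k := by rw [h12 k i j, h23 i k j]
  let f : Fin 3 → Y := ![⟨g i, hg i⟩, ⟨g j, hg j⟩, ⟨g k, hg k⟩]
  have hli : LinearIndependent ℂ f := by
    rw [Fintype.linearIndependent_iff]
    intro c hc m
    have hc' : ∀ a b : Fin 5, c 0 * g i a b + c 1 * g j a b + c 2 * g k a b = 0 := by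
      intro a b
      have := congrArg (fun y : Y => (y : Fin 5 → Fin 5 → ℂ) a b) hc
      simpa [f, Fin.sum_univ_three] using this
    have h0 : c 0 = 0 := by
      have := hc' j k
      rw [e1, e2] at this
      have : c 0 * g i j k = 0 := by linear_combination this
      exact (mul_eq_zero.mp this).resolve_right hijk
    have h1 : c 1 = 0 := by
      have := hc' i k
      rw [e3, e7, e4] at this
      have : c 1 * g i j k = 0 := by linear_combination this
      exact (mul_eq_zero.mp this).resolve_right hijk
    have h2 : c 2 = 0 := by
      have := hc' i j
      rw [e5, e6, e8] at this
      have : c 2 * g i j k = 0 := by linear_combination this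
      exact (mul_eq_zero.mp this).resolve_right hijk
    fin_cases m
    · exact h0
    · exact h1
    · exact h2
  have := hli.fintype_card_le_finrank
  simp only [Fintype.card_fin] at this
  exact this

/-- ★ **BINARY KILL.**  If the three (symmetric) triangle spans have trivial triple intersection and all their matrices kill a
common space `K` of vectors with `finrank K ≥ 3` (e.g. they lie in a binary net `Sym² L`, `K = L^⊥`), then NO nonzero symmetric
zero-diagonal leaf matrix is captured: `finrank W = 0`.  The `K`-contractions `Σ_r k_r A_r` of the finite form lie in
`U₀₁ ⊓ U₀₂ ⊓ U₁₂` by the two pencils, so every contraction `T_μ(p,q,·)·k` vanishes; hence the slices of `T_μ` span a space of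
dimension `≤ 5 − 3 = 2`, which for a nonzero square-free `T_μ` is impossible (`three_le_finrank_of_sqfree_slices`). [folklore] -/
theorem finrank_eq_zero_of_triple_free_of_common_kernel (U01 U02 U12 W : Submodule ℂ (Fin 5 → Fin 5 → ℂ))
    (h01 : ∀ x ∈ U01, ∀ p q : Fin 5, x p q = x q p) (h02 : ∀ x ∈ U02, ∀ p q : Fin 5, x p q = x q p)
    (h12 : ∀ x ∈ U12, ∀ p q : Fin 5, x p q = x q p) (hbot : U01 ⊓ U02 ⊓ U12 = ⊥)
    (K : Submodule ℂ (Fin 5 → ℂ)) (hK : 3 ≤ Module.finrank ℂ K)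
    (hkill : ∀ x ∈ U01 ⊔ U02 ⊔ U12, ∀ k ∈ K, ∀ p : Fin 5, ∑ r, x p r * k r = 0)
    (hWs : ∀ μ ∈ W, ∀ s t : Fin 5, μ s t = μ t s) (hWd : ∀ μ ∈ W, ∀ s : Fin 5, μ s s = 0)
    (hWc : ∀ μ ∈ W, contractZ μ ∈ L3 U01 U02 U12) :
    Module.finrank ℂ W = 0 := by
  classical
  rw [Submodule.finrank_eq_zero, Submodule.eq_bot_iff]
  intro μ hμ
  obtain ⟨A, B, C, hA, hB, hC, hT⟩ := L3_finite_form U01 U02 U12 (hWc μ hμ)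
  -- membership of the three families in the total span
  have hA' : ∀ x, A x ∈ U01 ⊔ U02 ⊔ U12 := fun x => Submodule.mem_sup_left (Submodule.mem_sup_left (hA x))
  have hB' : ∀ x, B x ∈ U01 ⊔ U02 ⊔ U12 := fun x => Submodule.mem_sup_left (Submodule.mem_sup_right (hB x))
  have hC' : ∀ x, C x ∈ U01 ⊔ U02 ⊔ U12 := fun x => Submodule.mem_sup_right (hC x)
  -- the two pencils are fully symmetric (as in ✓ `finrank_le_prolong_add_prolong_of_inf_eq_bot`)
  have hG13₁ : ∀ x y z, A x y z - B x y z = A z y x - B z y x := fun x y z => by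
    have h := contractZ_swap23 μ y x z
    rw [hT, hT] at h
    have hc := h12 _ (hC y) z x
    linear_combination h - hc
  have hG23₁ : ∀ x y z, A x y z - B x y z = A x z y - B x z y := fun x y z => by
    rw [h01 _ (hA x) y z, h02 _ (hB x) y z]
  have hG13₂ : ∀ x y z, A x y z - C x y z = A z y x - C z y x := fun x y z => by
    have h : contractZ μ z y x = contractZ μ x y z := by
      rw [contractZ_swap12 μ y z x, contractZ_swap23 μ y x z, contractZ_swap12 μ x y z]
    rw [hT, hT] at h
    have hb := h02 _ (hB y) z x
    have ha1 := h01 _ (hA x) z y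
    have ha2 := h01 _ (hA z) x y
    linear_combination h - hb - ha1 + ha2
  have hG23₂ : ∀ x y z, A x y z - C x y z = A x z y - C x z y := fun x y z => by
    rw [h01 _ (hA x) y z, h12 _ (hC x) y z]
  -- `(r p q) → (p q r)` for both pencils
  have hcyc₁ : ∀ r p q, A r p q - B r p q = A p q r - B p q r := fun r p q => by
    rw [hG13₁ r p q, hG23₁ q p r, hG13₁ q r p, hG23₁ p r q]
  have hcyc₂ : ∀ r p q, A r p q - C r p q = A p q r - C p q r := fun r p q => by
    rw [hG13₂ r p q, hG23₂ q p r, hG13₂ q r p, hG23₂ p r q]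
  -- the `K`-contractions of `A` vanish
  have hMA : ∀ k ∈ K, ∀ p q, ∑ r, k r * A r p q = 0 := by
    intro k hk p q
    let M : Fin 5 → Fin 5 → ℂ := fun p q => ∑ r, k r * A r p q
    have hM : M = ∑ r, k r • A r := by
      funext a b
      simp only [M, Finset.sum_apply, Pi.smul_apply, smul_eq_mul]
    have m1 : M ∈ U01 := by rw [hM]; exact U01.sum_mem fun r _ => U01.smul_mem _ (hA r)
    have m2 : M ∈ U02 := by
      have e : M = ∑ r, k r • B r := by
        funext a b
        simp only [M, Finset.sum_apply, Pi.smul_apply, smul_eq_mul]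
        have hrow : ∑ r, (A a b r - B a b r) * k r = 0 := by
          have h1 := hkill _ (hA' a) k hk b
          have h2 := hkill _ (hB' a) k hk b
          rw [← sub_eq_zero.mpr (h1.trans h2.symm), ← Finset.sum_sub_distrib]
          refine Finset.sum_congr rfl fun r _ => by ring
        have : ∑ r, k r * A r a b = ∑ r, k r * B r a b + ∑ r, (A a b r - B a b r) * k r := by
          rw [← Finset.sum_add_distrib]
          refine Finset.sum_congr rfl fun r _ => ?_
          rw [← hcyc₁ r a b]; ring
        rw [this, hrow, add_zero]
      rw [e]; exact U02.sum_mem fun r _ => U02.smul_mem _ (hB r)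
    have m3 : M ∈ U12 := by
      have e : M = ∑ r, k r • C r := by
        funext a b
        simp only [M, Finset.sum_apply, Pi.smul_apply, smul_eq_mul]
        have hrow : ∑ r, (A a b r - C a b r) * k r = 0 := by
          have h1 := hkill _ (hA' a) k hk b
          have h2 := hkill _ (hC' a) k hk b
          rw [← sub_eq_zero.mpr (h1.trans h2.symm), ← Finset.sum_sub_distrib]
          refine Finset.sum_congr rfl fun r _ => by ring
        have : ∑ r, k r * A r a b = ∑ r, k r * C r a b + ∑ r, (A a b r - C a b r) * k r := by
          rw [← Finset.sum_add_distrib]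
          refine Finset.sum_congr rfl fun r _ => ?_
          rw [← hcyc₂ r a b]; ring
        rw [this, hrow, add_zero]
      rw [e]; exact U12.sum_mem fun r _ => U12.smul_mem _ (hC r)
    have hmem : M ∈ U01 ⊓ U02 ⊓ U12 := Submodule.mem_inf.mpr ⟨Submodule.mem_inf.mpr ⟨m1, m2⟩, m3⟩
    rw [hbot, Submodule.mem_bot] at hmem
    exact congrFun (congrFun hmem p) q
  -- hence every contraction `T_μ(p,q,·)·k` vanishes
  have hTk : ∀ k ∈ K, ∀ p q, ∑ r, contractZ μ p q r * k r = 0 := by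
    intro k hk p q
    have h1 := hMA k hk p q
    have h2 := hkill _ (hB' q) k hk p
    have h3 := hkill _ (hC' p) k hk q
    have : ∑ r, contractZ μ p q r * k r = ∑ r, k r * A r p q + ∑ r, B q p r * k r + ∑ r, C p q r * k r := by
      rw [← Finset.sum_add_distrib, ← Finset.sum_add_distrib]
      refine Finset.sum_congr rfl fun r _ => ?_
      rw [hT]; ring
    rw [this, h1, h2, h3, add_zero, add_zero]
  -- the contraction map `v ↦ T_μ(·,·,v)` kills `K`, so its range has `finrank ≤ 2`, yet contains the slices
  let Ψ : (Fin 5 → ℂ) →ₗ[ℂ] (Fin 5 → Fin 5 → ℂ) :=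
    { toFun := fun v p q => ∑ r, contractZ μ p q r * v r
      map_add' := fun v w => by
        funext p q
        simp only [Pi.add_apply, mul_add, Finset.sum_add_distrib]
      map_smul' := fun c v => by
        funext p q
        simp only [Pi.smul_apply, smul_eq_mul, RingHom.id_apply, Finset.mul_sum]
        refine Finset.sum_congr rfl fun r _ => by ring }
  have hΨ : ∀ v p q, Ψ v p q = ∑ r, contractZ μ p q r * v r := fun v p q => rfl
  have hKle : K ≤ LinearMap.ker Ψ := fun k hk => by
    rw [LinearMap.mem_ker]
    funext p q
    rw [hΨ, hTk k hk p q]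
    rfl
  have hrank : Module.finrank ℂ (LinearMap.range Ψ) ≤ 2 := by
    have h := LinearMap.finrank_range_add_finrank_ker Ψ
    rw [Module.finrank_fin_fun] at h
    have := Submodule.finrank_mono hKle
    omega
  have hsl : ∀ x, contractZ μ x ∈ LinearMap.range Ψ := fun x => by
    refine LinearMap.mem_range.mpr ⟨Pi.single x 1, ?_⟩
    funext p q
    rw [hΨ, Finset.sum_eq_single x (fun r _ hr => by rw [Pi.single_eq_of_ne hr, mul_zero])
      (fun h => absurd (Finset.mem_univ x) h), Pi.single_eq_same, mul_one]
    -- `T(p,q,x) = T(x,p,q)`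
    rw [← contractZ_swap23 μ p q x]
    exact contractZ_swap12 μ x p q
  by_contra hne
  have hT0 : contractZ μ ≠ 0 := by
    intro h0
    apply hne
    refine hub_injective μ (hWs μ hμ) (hWd μ hμ) fun p q => ?_
    simp [h0]
  have h3 := three_le_finrank_of_sqfree_slices (LinearMap.range Ψ) (contractZ μ)
    (fun p q r => (contractZ_swap12 μ p q r).symm) (fun p q r => (contractZ_swap23 μ p q r).symm)
    (fun p r => contractZ_rep12 μ p r) hT0 hsl
  omega

/-- ★★ **`(SC)` FOR THE `(2,2,2)♭` TRIANGLE FAMILY: three symmetric spans with TRIVIAL TRIPLE INTERSECTION inside a symmetric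
3-space `X`, of total finrank `≥ 6` (e.g. three planes of `X` pairwise meeting in three independent lines).**  If
`finrank (prolong X) ≤ 3`: the two-pencil bound (✓ `captureIneqSym_of_triple_free_of_prolong_le_three`); else `X` is a binary
net (✓ `exists_rows_le_two_of_finrank_prolong`), the common kernel `K = L^⊥` has `finrank ≥ 3`, and the binary kill gives
`W = 0`. [folklore] -/
theorem captureIneqSym_of_triangle (U01 U02 U12 W X : Submodule ℂ (Fin 5 → Fin 5 → ℂ))
    (hXs : ∀ x ∈ X, ∀ p q : Fin 5, x p q = x q p) (hX1 : U01 ≤ X) (hX2 : U02 ≤ X) (hX3 : U12 ≤ X)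
    (hX : Module.finrank ℂ X ≤ 3) (hbot : U01 ⊓ U02 ⊓ U12 = ⊥)
    (h6 : 6 ≤ Module.finrank ℂ U01 + Module.finrank ℂ U02 + Module.finrank ℂ U12)
    (hWs : ∀ μ ∈ W, ∀ s t : Fin 5, μ s t = μ t s) (hWd : ∀ μ ∈ W, ∀ s : Fin 5, μ s s = 0)
    (hWc : ∀ μ ∈ W, contractZ μ ∈ L3 U01 U02 U12) :
    Module.finrank ℂ W ≤ Module.finrank ℂ U01 + Module.finrank ℂ U02 + Module.finrank ℂ U12 := by
  classical
  have h01 : ∀ x ∈ U01, ∀ p q : Fin 5, x p q = x q p := fun x hx => hXs x (hX1 hx)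
  have h02 : ∀ x ∈ U02, ∀ p q : Fin 5, x p q = x q p := fun x hx => hXs x (hX2 hx)
  have h12 : ∀ x ∈ U12, ∀ p q : Fin 5, x p q = x q p := fun x hx => hXs x (hX3 hx)
  by_cases hp : Module.finrank ℂ (prolong X) ≤ 3
  · exact captureIneqSym_of_triple_free_of_prolong_le_three U01 U02 U12 W X h01 h02 h12 hbot (sup_le hX1 hX2)
      (sup_le hX1 hX3) hp h6 hWs hWd hWc
  obtain ⟨p, hL, hrows⟩ := exists_rows_le_two_of_finrank_prolong X hXs hX (by omega)
  -- the pairing with `L = L_p` and its kernel `K`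
  let Bil : (Fin 5 → ℂ) →ₗ[ℂ] (Fin 5 → ℂ) →ₗ[ℂ] ℂ :=
    LinearMap.mk₂ ℂ (fun l k : Fin 5 → ℂ => ∑ r, l r * k r)
      (fun l l' k => by simp only [Pi.add_apply, add_mul, Finset.sum_add_distrib])
      (fun c l k => by simp only [Pi.smul_apply, smul_eq_mul, Finset.mul_sum, mul_assoc])
      (fun l k k' => by simp only [Pi.add_apply, mul_add, Finset.sum_add_distrib])
      (fun c l k => by simp only [Pi.smul_apply, smul_eq_mul, Finset.mul_sum, mul_left_comm])
  let dotL : (Fin 5 → ℂ) →ₗ[ℂ] Module.Dual ℂ (rowIm X p) := (Bil.domRestrict (rowIm X p)).flip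
  have hdotL : ∀ (k : Fin 5 → ℂ) (l : rowIm X p), dotL k l = ∑ r, (l : Fin 5 → ℂ) r * k r := fun k l => rfl
  have hK : 3 ≤ Module.finrank ℂ (LinearMap.ker dotL) := by
    have h := LinearMap.finrank_range_add_finrank_ker dotL
    rw [Module.finrank_fin_fun] at h
    have e : Module.finrank ℂ (Module.Dual ℂ (rowIm X p)) = Module.finrank ℂ (rowIm X p) := Subspace.dual_finrank_eq
    have hr : Module.finrank ℂ (LinearMap.range dotL) ≤ Module.finrank ℂ (Module.Dual ℂ (rowIm X p)) :=
      Submodule.finrank_le _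
    omega
  have hkill : ∀ x ∈ U01 ⊔ U02 ⊔ U12, ∀ k ∈ LinearMap.ker dotL, ∀ q : Fin 5, ∑ r, x q r * k r = 0 := by
    intro x hx k hk q
    have hxX : x ∈ X := (sup_le (sup_le hX1 hX2) hX3) hx
    have hk0 := LinearMap.mem_ker.mp hk
    have := congrArg (fun φ : Module.Dual ℂ (rowIm X p) => φ ⟨x q, hrows x hxX q⟩) hk0
    simpa [hdotL] using this
  have h0 := finrank_eq_zero_of_triple_free_of_common_kernel U01 U02 U12 W h01 h02 h12 hbot (LinearMap.ker dotL) hK hkill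
    hWs hWd hWc
  omega

end LaplaceFiveSeparatedCapture

end Summit.ValiantsHypothesis.ValiantsHypothesis.Theorems.RigidityForcesSymmetryRankRigidMinimalRepr
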